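import Mathlib
import Literature.Computability.AlgebraicComplexity.OrbitClosureWeights
import Summits.ValiantsHypothesis.ValiantsHypothesis.Theorems.ValuativeGCTValuativeFlipSmallBodyWeightVectors
import Summits.ValiantsHypothesis.ValiantsHypothesis.Theorems.ValuativeGCTValuativeFlipBouquetTestForms

/-!
# The bouquet criterion: a factor-sensitive no-equation criterion for `Det_m`

Wall-breaker axis D (det-orbit-closure multiplicity bounds) for crux `ValuativeGCT.ValuativeFlip`
(stmt-ValiantsHypothesis-12624).  Coordinates on `Sym^m k^{m×m}` are `X_d`, `d` an exponent vector of
degree `m` in the letters `MatIdx m`; fix a base letter `i₀` and write `γ(d) = d|_{i ≠ i₀}`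
(`|γ(d)| = m - d i₀`, the *body* of the factor `X_d`; `d₀ = m·e_{i₀}` is the unique factor of body `0`).

**Theorem (`exists_aeval_formCoeff_linSubst_detFormLex_ne_zero_of_bouquet`).**  Let `F` be a
homogeneous polynomial in the `X_d` and let `s` be a monomial of `F` whose DISTINCT factors satisfy the
bouquet budget `1 + ∑_{d ∈ supp s} (|γ(d)| - 1) ≤ m`.  Then `F(A · det_m) ≠ 0` for some
`A ∈ End(k^{m×m})`; in particular (`not_mem_orbitVanishingIdeal_detFormLex_of_bouquet`) `F` is not an
equation of the determinant orbit closure `Δ(det_m)`.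

Proof: the bouquet test form `G_t = x_{i₀}^m + ∑_{d ∈ supp s, d ≠ d₀} t_d x_{i₀}^{d i₀} x^{γ(d)}` lies in
`End · det_m` exactly under the budget (`…BouquetTestForms`); its coefficient vector is `1` at `d₀`,
`t_d` at the body factors of `s`, and `0` elsewhere, so `F(G_t) = ∑_{s'} F_{s'} t^{s'|_{≠ d₀}}` over the
monomials `s'` of `F` supported inside `supp s ∪ {d₀}`, and the coefficient of `t^{s|_{≠ d₀}}` is `F_s ≠ 0`
(homogeneity pins the exponent of `X_{d₀}`).  This contains the small-body theorems of k3/k7 (body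
`≤ m`: every monomial meets the budget) and reaches body `m + 1` (`…NoBodySuccEquations`); beyond, it
says that every equation of `Det_m` has only monomials with few, fat body factors
(`…DetEquationDivisibility`).  Characteristic zero (an infinite field suffices); no definitions.
[new]
-/

set_option linter.dupNamespace false

namespace Summit.ValiantsHypothesis.ValiantsHypothesis.Theorems.ValuativeFlip

open MvPolynomial
open scoped BigOperators Matrix
open Literature.NumberTheory.DiophantineGeometry
open Literature.Computability.AlgebraicComplexity

noncomputable section

/-- The word of an exponent vector: listing the multiset of `γ` and multiplying the corresponding
variables gives the monomial `x^γ`. [folklore] -/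
theorem bq_prod_X_toList {L : Type*} {R : Type*} [CommSemiring R] [Nontrivial R] (γ : L →₀ ℕ) {n : ℕ}
    (hn : γ.toMultiset.toList.length = n) :
    ∏ t : Fin n, (X (γ.toMultiset.toList.get (Fin.cast hn.symm t)) : MvPolynomial L R) =
      monomial γ 1 := by
  classical
  subst hn
  have h1 : ∏ t : Fin γ.toMultiset.toList.length,
      (X (γ.toMultiset.toList.get (Fin.cast rfl t)) : MvPolynomial L R) =
      (γ.toMultiset.toList.map (fun l => (X l : MvPolynomial L R))).prod := by
    rw [← List.prod_ofFn, List.ofFn_comp' _ (fun l => (X l : MvPolynomial L R))]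
    congr 1
    congr 1
    exact List.ofFn_get _
  rw [h1, ← Multiset.prod_coe, ← Multiset.map_coe, Multiset.coe_toList, Finsupp.toMultiset_map,
    Finsupp.prod_toMultiset, Finsupp.prod_mapDomain_index_inj (X_injective (σ := L) (R := R)),
    monomial_eq, C_1, one_mul]

/-- The length of the word of `γ` is its degree. [folklore] -/
theorem bq_length_toList {L : Type*} (γ : L →₀ ℕ) : γ.toMultiset.toList.length = γ.degree := by
  rw [Multiset.length_toList, Finsupp.card_toMultiset, Finsupp.degree_apply]
  rfl

/-- Coefficient extraction at a sparse point.  Let `F` be homogeneous (in the variables `d : τ`), `s` a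
monomial of `F`, `d₀ : τ`, and evaluate `F` at `val d = 1` (`d = d₀`), `X d` (`d ∈ supp s`, `d ≠ d₀`), `0`
(otherwise), in the polynomial ring `R[X_d]`.  Then the coefficient of `X^{s|_{d ≠ d₀}}` in `F(val)` is the
coefficient `F_s`. [folklore] -/
theorem bq_coeff_erase_aeval_sparse {τ : Type*} [DecidableEq τ] {R : Type*} [CommRing R]
    {F : MvPolynomial τ R} {D : ℕ} (hF : F.IsHomogeneous D) {s : τ →₀ ℕ} (hs : s ∈ F.support) (d₀ : τ) :
    coeff (Finsupp.erase d₀ s) (aeval (fun d : τ => if d = d₀ then (1 : MvPolynomial τ R)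
        else if d ∈ s.support then X d else 0) F) = coeff s F := by
  classical
  set val : τ → MvPolynomial τ R := fun d => if d = d₀ then (1 : MvPolynomial τ R)
    else if d ∈ s.support then X d else 0 with hval
  -- the value of a monomial supported inside `supp s ∪ {d₀}`
  have hgood : ∀ s' : τ →₀ ℕ, (∀ d ∈ s'.support, d ≠ d₀ → d ∈ s.support) →
      ∏ d ∈ s'.support, val d ^ s' d = monomial (Finsupp.erase d₀ s') 1 := by
    intro s' hs'
    have h1 : ∏ d ∈ s'.support, val d ^ s' d =
        ∏ d ∈ s'.support, (if d ≠ d₀ then (X d : MvPolynomial τ R) ^ s' d else 1) := by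
      refine Finset.prod_congr rfl fun d hd => ?_
      by_cases h : d = d₀
      · rw [hval]; simp [h]
      · rw [hval]; simp [h, hs' d hd h]
    rw [h1, ← Finset.prod_filter, Finset.filter_ne', monomial_eq, C_1, one_mul, Finsupp.prod,
      Finsupp.support_erase]
    refine Finset.prod_congr rfl fun d hd => ?_
    rw [Finsupp.erase_ne (Finset.ne_of_mem_erase hd)]
  -- the value of a monomial leaving `supp s ∪ {d₀}`
  have hbad : ∀ s' : τ →₀ ℕ, (∃ d ∈ s'.support, d ≠ d₀ ∧ d ∉ s.support) →
      ∏ d ∈ s'.support, val d ^ s' d = 0 := by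
    rintro s' ⟨d, hd, hd0, hds⟩
    refine Finset.prod_eq_zero hd ?_
    rw [hval]
    simp only [hd0, if_false, hds]
    exact zero_pow (Finsupp.mem_support_iff.mp hd)
  -- expand `F(val)`
  change coeff (Finsupp.erase d₀ s) (eval₂ (algebraMap R (MvPolynomial τ R)) val F) = coeff s F
  rw [eval₂_eq, coeff_sum, Finset.sum_eq_single s]
  · rw [hgood s (fun d hd _ => hd), MvPolynomial.algebraMap_eq, coeff_C_mul, coeff_monomial,
      if_pos rfl, mul_one]
  · intro s' hs' hne
    rw [MvPolynomial.algebraMap_eq, coeff_C_mul]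
    by_cases hcase : ∃ d ∈ s'.support, d ≠ d₀ ∧ d ∉ s.support
    · rw [hbad s' hcase, coeff_zero, mul_zero]
    · push Not at hcase
      rw [hgood s' (fun d hd hd0 => hcase d hd hd0), coeff_monomial, if_neg, mul_zero]
      intro heq
      apply hne
      -- `s'` and `s` agree off `d₀` and have the same degree
      have hdegF : ∀ u ∈ F.support, u.degree = D := fun u hu => by
        have := hF (mem_support_iff.mp hu)
        rw [Finsupp.degree_eq_weight_one]
        exact this
      have hdeg : s'.degree = s.degree := by rw [hdegF s' hs', hdegF s hs]
      have hoff : ∀ d, d ≠ d₀ → s' d = s d := fun d hd => by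
        have := congrArg (fun f => f d) heq
        simpa only [Finsupp.erase_ne hd] using this
      have hsplit : ∀ f : τ →₀ ℕ, f.degree = (Finsupp.erase d₀ f).degree + f d₀ := fun f => by
        conv_lhs => rw [← Finsupp.erase_add_single d₀ f]
        rw [map_add, Finsupp.degree_single]
      have hd0 : s' d₀ = s d₀ := by
        have e1 := hsplit s'
        have e2 := hsplit s
        rw [heq] at e1
        omega
      ext d
      by_cases hd : d = d₀
      · rw [hd]; exact hd0
      · exact hoff d hd
  · intro h; exact absurd hs h


/-- **The bouquet criterion.**  Let `F` be a homogeneous polynomial in the coordinates `X_d` of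
`Sym^m k^{m×m}` and `s` a monomial of `F` whose distinct factors meet the bouquet budget
`1 + ∑_{d ∈ supp s} (m - d i₀ - 1) ≤ m` at the base letter `i₀` (the factor `X_{d₀}`, `d₀ = m·e_{i₀}`,
costs nothing; a factor of body `a = m - d i₀ ≥ 1` costs `a - 1`).  Then `F(A · det_m) ≠ 0` for some
`A ∈ End(k^{m×m})`: the bouquet test form through the body factors of `s`, at a suitable parameter
value.  Registered sub-goal of the crux (wall-breaker k7, axis D). [new] -/
theorem exists_aeval_formCoeff_linSubst_detFormLex_ne_zero_of_bouquet {k : Type*} [Field k] [CharZero k]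
    {m : ℕ} (i₀ : MatIdx m) {F : MvPolynomial (DegIdx (MatIdx m) m) k} {D : ℕ} (hF : F.IsHomogeneous D)
    {s : DegIdx (MatIdx m) m →₀ ℕ} (hs : s ∈ F.support)
    (hcost : 1 + ∑ d ∈ s.support, (m - d.1 i₀ - 1) ≤ m) :
    ∃ A : Matrix (MatIdx m) (MatIdx m) k,
      aeval (formCoeff m (linSubst (MatIdx m) k A (detFormLex k m))) F ≠ 0 := by
  classical
  -- the base factor `d₀` and the body map `γ`
  have hdegd : ∀ d : DegIdx (MatIdx m) m, d.1.degree = m := fun d => mem_degMonomials_iff.mp d.2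
  set d₀ : DegIdx (MatIdx m) m := ⟨Finsupp.single i₀ m, mem_degMonomials_iff.mpr (Finsupp.degree_single _ _)⟩
    with hd₀
  set γ : DegIdx (MatIdx m) m → ({i : MatIdx m // i ≠ i₀} →₀ ℕ) :=
    fun d => d.1.subtypeDomain (fun i => i ≠ i₀) with hγ
  have hγdeg : ∀ d : DegIdx (MatIdx m) m, (γ d).degree = m - d.1 i₀ := fun d => by
    have h1 := degree_eq_degree_subtypeDomain_add i₀ d.1
    have h2 := hdegd d
    show (d.1.subtypeDomain fun i => i ≠ i₀).degree = m - d.1 i₀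
    omega
  have hγinj : Function.Injective γ := by
    intro d₁ d₂ h
    apply Subtype.ext
    exact eq_of_subtypeDomain_eq_of_degree_eq i₀ h (by rw [hdegd d₁, hdegd d₂])
  have hγd₀ : γ d₀ = 0 := by
    ext ⟨i, hi⟩
    show (Finsupp.single i₀ m) i = 0
    rw [Finsupp.single_apply, if_neg (Ne.symm hi)]
  have hγ0 : ∀ d, γ d = 0 ↔ d = d₀ := fun d =>
    ⟨fun h => hγinj (h.trans hγd₀.symm), fun h => by rw [h, hγd₀]⟩
  -- the petals: distinct body factors of `s`
  set B : Finset (DegIdx (MatIdx m) m) := s.support.erase d₀ with hB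
  set ℓ : B → ℕ := fun d => (γ d.1).degree - 1 with hℓ
  have hℓ1 : ∀ d : B, ℓ d + 1 = (γ d.1).degree := fun d => by
    have hne : γ d.1 ≠ 0 := fun h => Finset.ne_of_mem_erase d.2 ((hγ0 _).mp h)
    have hpos : 0 < (γ d.1).degree := by
      rw [pos_iff_ne_zero, Ne, Finsupp.degree_eq_zero_iff]
      exact hne
    show (γ d.1).degree - 1 + 1 = (γ d.1).degree
    omega
  have hlen : ∀ d : B, (γ d.1).toMultiset.toList.length = ℓ d + 1 := fun d => by
    rw [bq_length_toList, hℓ1]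
  set wL : (d : B) → Fin (ℓ d + 1) → {i : MatIdx m // i ≠ i₀} :=
    fun d t => (γ d.1).toMultiset.toList.get (Fin.cast (hlen d).symm t) with hwL
  -- the budget
  have hbudget : 1 + ∑ d : B, ℓ d ≤ m := by
    have h1 : ∑ d : B, ℓ d = ∑ d ∈ B, (m - d.1 i₀ - 1) := by
      rw [← Finset.sum_coe_sort B (fun d => m - d.1 i₀ - 1)]
      refine Finset.sum_congr rfl fun d _ => ?_
      show (γ d.1).degree - 1 = m - d.1.1 i₀ - 1
      rw [hγdeg]
    have h2 : ∑ d ∈ B, (m - d.1 i₀ - 1) ≤ ∑ d ∈ s.support, (m - d.1 i₀ - 1) :=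
      Finset.sum_le_sum_of_subset (Finset.erase_subset _ _)
    omega
  -- the bouquet test form through the body factors of `s`
  obtain ⟨A, hA⟩ := bq_exists_dehomog_linSubst_detFormLex
    (C : k →+* MvPolynomial (DegIdx (MatIdx m) m) k) i₀ ℓ (fun d t => (wL d t).1) (fun d t => (wL d t).2)
    (fun d : B => (X d.1 : MvPolynomial (DegIdx (MatIdx m) m) k)) hbudget
  have hprod : ∀ d : B, ∏ t : Fin (ℓ d + 1),
      (X (wL d t) : MvPolynomial {i : MatIdx m // i ≠ i₀} (MvPolynomial (DegIdx (MatIdx m) m) k)) =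
        monomial (γ d.1) 1 := fun d =>
    bq_prod_X_toList (R := MvPolynomial (DegIdx (MatIdx m) m) k) (γ d.1) (hlen d)
  -- its coefficient vector: `1` at `d₀`, `X d` at the body factors of `s`, `0` elsewhere
  have hcoef : (fun d : DegIdx (MatIdx m) m =>
      coeff d.1 (linSubst (MatIdx m) (MvPolynomial (DegIdx (MatIdx m) m) k) A
        (map (C : k →+* MvPolynomial (DegIdx (MatIdx m) m) k) (detFormLex k m)))) =
      fun d => if d = d₀ then (1 : MvPolynomial (DegIdx (MatIdx m) m) k)
        else if d ∈ s.support then X d else 0 := by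
    funext d
    rw [← coeff_subtypeDomain_aeval_dehomog i₀
      (linSubst_isHomogeneous _ ((detFormLex_isHomogeneous k m).map _)) d.1 (hdegd d), hA]
    change coeff (γ d) _ = _
    have hterm : ∀ d' : B, coeff (γ d) ((X d'.1 : MvPolynomial (DegIdx (MatIdx m) m) k) •
        ∏ t : Fin (ℓ d' + 1), (X ⟨(wL d' t).1, (wL d' t).2⟩ :
          MvPolynomial {i : MatIdx m // i ≠ i₀} (MvPolynomial (DegIdx (MatIdx m) m) k))) =
        if d'.1 = d then (X d'.1 : MvPolynomial (DegIdx (MatIdx m) m) k) else 0 := by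
      intro d'
      have he : (fun t : Fin (ℓ d' + 1) => (X ⟨(wL d' t).1, (wL d' t).2⟩ :
          MvPolynomial {i : MatIdx m // i ≠ i₀} (MvPolynomial (DegIdx (MatIdx m) m) k))) =
          fun t => X (wL d' t) := rfl
      rw [he, hprod d', smul_eq_C_mul, coeff_C_mul, coeff_monomial]
      by_cases h : d'.1 = d
      · rw [if_pos (congrArg γ h), if_pos h, mul_one]
      · rw [if_neg (fun h' => h (hγinj h')), if_neg h, mul_zero]
    rw [coeff_add, coeff_one, coeff_sum, Finset.sum_congr rfl (fun d' _ => hterm d'),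
      Finset.sum_coe_sort B (fun x => if x = d then (X x : MvPolynomial (DegIdx (MatIdx m) m) k) else 0),
      Finset.sum_ite_eq' B d]
    by_cases hd : d = d₀
    · have h0 : (0 : {i : MatIdx m // i ≠ i₀} →₀ ℕ) = γ d := by rw [(hγ0 d).mpr hd]
      have hnB : d ∉ B := by rw [hd, hB]; exact Finset.notMem_erase d₀ _
      rw [if_pos h0, if_pos hd, if_neg hnB, add_zero]
    · have hne : (0 : {i : MatIdx m // i ≠ i₀} →₀ ℕ) ≠ γ d := fun h => hd ((hγ0 d).mp h.symm)
      rw [if_neg hne, if_neg hd, zero_add]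
      by_cases hds : d ∈ s.support
      · have hdB : d ∈ B := by rw [hB]; exact Finset.mem_erase.mpr ⟨hd, hds⟩
        rw [if_pos hdB, if_pos hds]
      · have hdB : d ∉ B := by rw [hB]; exact fun h => hds (Finset.mem_of_mem_erase h)
        rw [if_neg hdB, if_neg hds]
  -- `F` at the test form is a nonzero polynomial in the parameters
  have hne : aeval (fun d : DegIdx (MatIdx m) m =>
      coeff d.1 (linSubst (MatIdx m) (MvPolynomial (DegIdx (MatIdx m) m) k) A
        (map (C : k →+* MvPolynomial (DegIdx (MatIdx m) m) k) (detFormLex k m)))) F ≠ 0 := by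
    rw [hcoef]
    intro h0
    have h1 := bq_coeff_erase_aeval_sparse (R := k) hF hs d₀
    rw [h0, coeff_zero] at h1
    exact (mem_support_iff.mp hs) h1.symm
  -- specialise the parameters
  obtain ⟨x, hx⟩ := exists_eval_ne_zero_of_ne_zero hne
  refine ⟨A.map (eval x), ?_⟩
  rw [← aeval_aeval_coeff_linSubst_map]
  exact hx

/-- **Bouquet criterion, ideal form.**  A homogeneous `F` having a monomial within the bouquet budget is
not an equation of `Δ(det_m)` (`orbitVanishingIdeal`), by the generic orbit map
(`eval_genericOrbitMap`, `orbitVanishingIdeal_eq_ker_genericOrbitMap`). [new] -/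
theorem not_mem_orbitVanishingIdeal_detFormLex_of_bouquet {k : Type*} [Field k] [CharZero k]
    {m : ℕ} (i₀ : MatIdx m) {F : MvPolynomial (DegIdx (MatIdx m) m) k} {D : ℕ} (hF : F.IsHomogeneous D)
    {s : DegIdx (MatIdx m) m →₀ ℕ} (hs : s ∈ F.support)
    (hcost : 1 + ∑ d ∈ s.support, (m - d.1 i₀ - 1) ≤ m) :
    F ∉ orbitVanishingIdeal (detFormLex k m) m := by
  intro hI
  obtain ⟨A, hA⟩ := exists_aeval_formCoeff_linSubst_detFormLex_ne_zero_of_bouquet i₀ hF hs hcost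
  apply hA
  rw [← eval_genericOrbitMap]
  have h0 : genericOrbitMap (detFormLex k m) m F = 0 := by
    rw [orbitVanishingIdeal_eq_ker_genericOrbitMap] at hI
    exact RingHom.mem_ker.mp hI
  rw [h0, map_zero]

/-- The bouquet budget of a monomial with at most one distinct body factor is `≤ m`, and with `≥ 2`
distinct body factors it is `≤ 1 + body - 2`; so a monomial of body `≤ m + 1` (body counted with
multiplicity, `∑_d s(d) (m - d i₀)`) always meets the budget. [new, elementary] -/
theorem bq_cost_le_of_body_le_succ {m : ℕ} (hm : 0 < m) (i₀ : MatIdx m) (s : DegIdx (MatIdx m) m →₀ ℕ)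
    (hbody : ∑ d ∈ s.support, s d * (m - d.1 i₀) ≤ m + 1) :
    1 + ∑ d ∈ s.support, (m - d.1 i₀ - 1) ≤ m := by
  classical
  set Q : Finset (DegIdx (MatIdx m) m) := s.support.filter (fun d => 1 ≤ m - d.1 i₀) with hQ
  -- the factors of body `0` cost nothing
  have hsumQ : ∑ d ∈ s.support, (m - d.1 i₀ - 1) = ∑ d ∈ Q, (m - d.1 i₀ - 1) := by
    rw [hQ, Finset.sum_filter]
    refine Finset.sum_congr rfl fun d _ => ?_
    split_ifs with h
    · rfl
    · omega
  rw [hsumQ]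
  by_cases hcard : 2 ≤ Q.card
  · -- at least two distinct body factors
    have h1 : ∑ d ∈ Q, (m - d.1 i₀ - 1) + Q.card = ∑ d ∈ Q, (m - d.1 i₀) := by
      rw [Finset.card_eq_sum_ones, ← Finset.sum_add_distrib]
      refine Finset.sum_congr rfl fun d hd => ?_
      have := (Finset.mem_filter.mp hd).2
      omega
    have h2 : ∑ d ∈ Q, (m - d.1 i₀) ≤ ∑ d ∈ Q, s d * (m - d.1 i₀) := by
      refine Finset.sum_le_sum fun d hd => ?_
      have hsd : 1 ≤ s d := Nat.one_le_iff_ne_zero.mpr (Finsupp.mem_support_iff.mp (Finset.mem_filter.mp hd).1)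
      nlinarith
    have h3 : ∑ d ∈ Q, s d * (m - d.1 i₀) ≤ ∑ d ∈ s.support, s d * (m - d.1 i₀) :=
      Finset.sum_le_sum_of_subset (Finset.filter_subset _ _)
    omega
  · -- at most one distinct body factor
    have hle1 : Q.card ≤ 1 := by omega
    rcases Nat.lt_or_ge 0 Q.card with hpos | hzero
    · obtain ⟨d, hd⟩ := Finset.card_pos.mp hpos
      have hQeq : Q = {d} := Finset.eq_singleton_iff_unique_mem.mpr
        ⟨hd, fun d' hd' => Finset.card_le_one.mp hle1 d' hd' d hd⟩
      rw [hQeq, Finset.sum_singleton]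
      omega
    · have hQe : Q = ∅ := Finset.card_eq_zero.mp (by omega)
      rw [hQe, Finset.sum_empty]
      omega

/-- **Weight vectors of body `≤ m + 1` are not equations of `Det_m`.**  Let `F ≠ 0` lie in the weight
space of weight `χ` of `k[Sym^m k^{m×m}]` with `|χ| = -mD`, and let the body at the letter `i₀` satisfy
`mD + χ i₀ ≤ m + 1`.  Then `F ∉ I(GL · det_m)`.  (Body `≤ m` is the landed theorem of k7 seat 2 /
k3 seat 2, `not_mem_orbitVanishingIdeal_detFormLex_of_body_le` / `nsb_eq_zero_of_forall_body_le`; the bouquet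
criterion gives a third proof of it and one more unit of body.) [new] -/
theorem not_mem_orbitVanishingIdeal_detFormLex_of_body_le_succ {k : Type*} [Field k] [CharZero k] {m : ℕ}
    (i₀ : MatIdx m) {χ : Weight (MatIdx m)} {F : MvPolynomial (DegIdx (MatIdx m) m) k}
    (hF : F ∈ weightSpace (coordRep (MatIdx m) k m) χ) {D : ℕ}
    (hD : χ.size = -((m * D : ℕ) : ℤ)) (hbody : ((m * D : ℕ) : ℤ) + χ i₀ ≤ m + 1) (hF0 : F ≠ 0) :
    F ∉ orbitVanishingIdeal (detFormLex k m) m := by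
  classical
  have hm : 0 < m := Fin.pos (ofLex i₀).1
  have hdegd : ∀ d : DegIdx (MatIdx m) m, d.1.degree = m := fun d => mem_degMonomials_iff.mp d.2
  have hle : ∀ d : DegIdx (MatIdx m) m, d.1 i₀ ≤ m := fun d => by
    have h1 := degree_eq_degree_subtypeDomain_add i₀ d.1
    have h2 := hdegd d
    omega
  -- torus weights and degrees of the monomials of `F`
  have hw : ∀ s ∈ F.support, monWeight s = χ := fun s hs => monWeight_eq_of_mem_weightSpace hF hs
  have hdegs : ∀ s ∈ F.support, s.degree = D := by
    intro s hs
    have h1 := size_monWeight (σ := MatIdx m) s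
    rw [hw s hs, hD, neg_inj, Nat.cast_inj] at h1
    exact (Nat.eq_of_mul_eq_mul_left hm h1).symm
  have hhom : F.IsHomogeneous D := fun s hs => by
    have := hdegs s (mem_support_iff.mpr hs)
    rw [Finsupp.degree_eq_weight_one] at this
    exact this
  -- a monomial of `F` and its body
  obtain ⟨s, hs⟩ := support_nonempty.mpr hF0
  have key : ((∑ d ∈ s.support, s d * (m - d.1 i₀) : ℕ) : ℤ) = ((m * D : ℕ) : ℤ) + χ i₀ := by
    rw [← hw s hs, monWeight_apply, ← hdegs s hs, Finsupp.degree_apply, Finset.mul_sum,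
      Nat.cast_sum, Nat.cast_sum, Nat.cast_sum, ← sub_eq_add_neg, ← Finset.sum_sub_distrib]
    refine Finset.sum_congr rfl fun d _ => ?_
    rw [Nat.cast_mul, Nat.cast_sub (hle d), Nat.cast_mul, Nat.cast_mul]
    ring
  have hbody' : ∑ d ∈ s.support, s d * (m - d.1 i₀) ≤ m + 1 := by
    have h := hbody
    rw [← key] at h
    exact_mod_cast h
  exact not_mem_orbitVanishingIdeal_detFormLex_of_bouquet i₀ hhom hs (bq_cost_le_of_body_le_succ hm i₀ s hbody')

end

end Summit.ValiantsHypothesis.ValiantsHypothesis.Theorems.ValuativeFlip
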